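import Summits.ResolutionOfSingularities.ResolutionOfSingularities.Theses.FrobeniusClosing
import HarnessLib

/-!
# `FrobeniusClosing.Assembly` (stmt-ResolutionOfSingularities-16349) — PROVED

Route `ResolutionOfSingularities/FrobeniusClosing`. The route's assembly item is the implication

  `NoPeriodicIsolatedAtom → BoundedMilnor → ClosingReduction → Steer → TorsorToLurelPerfect →
   PatchingRelPerfect → DescentPerfectToAll → ResolutionOfSingularities`,

which is, hypothesis for hypothesis, the route file's planner-authored deciding theorem
`Theses.FrobeniusClosing.closes` (`fun p hp => hD p hp (hP p hp (hT p hp (hS (hCR hNP hBT) p hp)))`):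
the closing reduction turns the certificate and the Milnor bound into the target
`IsolatedForcedTermination`, steering turns termination of forced runs into local uniformization of
`α_p`-torsors over perfect ground fields, the torsor ⇒ LU_rel ⇒ patching chain resolves over perfect
fields, and descent removes perfectness. So the item holds by that theorem, with no open crux used.

(State of the chain, for the reader: `NoPeriodicIsolatedAtom` (stmt-16344) and `BoundedMilnor`
(stmt-16346) are CLOSED in the tree as of 2026-08-26 — `Theorems.FrobeniusClosing.noPeriodicIsolatedAtom_proof`,
`Theorems.FrobeniusClosing.BoundedMilnor_proof` — through `WildCones.ClassicalRegimes_proof`; the open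
items of the route are `Steer`, `TorsorToLurelPerfect`, `PatchingRelPerfect`, `DescentPerfectToAll`.)

This file replaces the role of no printed item; it is OURS (campaign res-hironaka, rung L, slot W4.1,
chain w41): a kernel assembly of statements of this tree, NOT a statement of Hironaka's manuscript.
-/

noncomputable section

-- single-problem summit: the doubled namespace component `ResolutionOfSingularities` is forced
set_option linter.dupNamespace false

namespace Summit.ResolutionOfSingularities.ResolutionOfSingularities.Theorems.FrobeniusClosing

open Summit.ResolutionOfSingularities.ResolutionOfSingularities.Theses.FrobeniusClosing
  (NoPeriodicIsolatedAtom BoundedMilnor ClosingReduction Steer TorsorToLurelPerfect PatchingRelPerfect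
    DescentPerfectToAll Assembly closes)

/-- **`FrobeniusClosing.Assembly` (item stmt-ResolutionOfSingularities-16349) holds**: the chain
`NoPeriodicIsolatedAtom → BoundedMilnor → ClosingReduction → Steer → TorsorToLurelPerfect →
PatchingRelPerfect → DescentPerfectToAll → ResolutionOfSingularities` is the route file's deciding
theorem `closes`. [folklore] -/
theorem assembly_proof : Assembly :=
  fun hNP hBT hCR hS hT hP hD => closes hNP hBT hCR hS hT hP hD

end Summit.ResolutionOfSingularities.ResolutionOfSingularities.Theorems.FrobeniusClosing

end
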